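import Literature.Barriers.CriticalPhenomena.PlaquetteWalkHoleRootTightNearCells
import Literature.Barriers.CriticalPhenomena.PlaquetteWalkHoleRootNearCells
import Literature.Barriers.CriticalPhenomena.PlaquetteWalkHoleRootRootNotchEast
import HarnessLib

/-!
# Barrier catalogue (SAWScalingLimit): LAW L FOR THE VERTICAL TRIOMINO HOLE — the cells below AND above the hole removed

Leaf of `PlaquetteWalkHoleRootTightNearCells` (dead door + floor / ceiling for ANY defect list; both doors dead ⇒ `VF ≡ 0` via
`PlaquetteWalkHoleRootDeadDoorBelow`), `PlaquetteWalkHoleRootRootNotchEast` (the generic one-route sign theorems) and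
`PlaquetteWalkHoleRootNearCells` (the every-position witness pattern). Setting: the
`m × n` box with the hole `h`, the root plaquette `(h.1 + 1, h.2)` rooted at `W`, the far cell `(h.1 − 1, h.2)`, and BOTH
`holeS = (h.1, h.2 − 1)` and `holeN = (h.1, h.2 + 1)` removed: `S = [h, holeS, holeN]` — a vertical slit of height three, the
first hole of the lane that is taller than the root plaquette.

§1 Four kit witnesses (kit j298316 of the lane, tasks `{(3,1),(3,3)} US2/US1/ON2/ON1 I7`, 24 arcs each, columns `[1,5]`, one
extra row on the witness's own side): `slitBlockSU2`, `slitBlockSU1` (under, rows `−1 … 4`), `slitBlockNO2`, `slitBlockNO1` (over,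
rows `0 … 5`), each avoiding `holeS` AND `holeN`, with `decide` certificates and every-position theorems.
§2 ★★★★★ `lawL_box_slit_not_killed` — `2 ≤ h.1`, `h.1 + 3 ≤ m`, three free rows below AND above (`3 ≤ h.2`, `h.2 + 4 ≤ n`) ⇒
NONE of the four kill statements of LAW L holds (the slit is harmless in the interior — even with `rootE` in the last column,
since no root notch is involved). §3 the tight cases: `lawL_box_slit_tightS_im_vertexFunctional_pos` (`h.2 = 2`, `h.2 + 4 ≤ n`:
under route EMPTY by the dead door below, `Im VF > 0` on `[π/3, 2π/3]` by the over slit witnesses), `…tightN…neg` (mirror), and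
★★★★ `lawL_box_slit_height5_vertexFunctional_eq_zero` — the slit in a box of height FIVE (`h.2 = 2`, `n = 5`: floor and
ceiling both two rows from the hole) ⇒ BOTH doors dead ⇒ `VF ≡ 0` on the range, for every width.

Not in print; venture lane «pcv-sawmu», seat b-step0 gen 28 (kit j298316 «nearpairs», HOME `code/step0/g28/kit/`).

References: A. Glazman, I. Manolescu, arXiv:1708.00395v3, §1 (Fig. 1, Fig. 2, remark after eq. (1)), §2.1, §4.2, Lemma 2.1
[GlazmanManolescu2019]; A. Glazman, Electron. Commun. Probab. 20 (2015) no. 86, Lemma 3.1, proof pp. 6–7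
[Glazman2015WeightedSAW]; R. Courant, H. Robbins, *What is Mathematics?* (1941/1958), Ch. V Appendix §2 (the even–odd
rule) [CourantRobbins1958].
-/

noncomputable section

open Set Function Complex

namespace Literature.Barriers.CriticalPhenomena.PlaquetteWalk

open Literature.Probability.RandomPlanarGeometry.SAW.YangBaxter
open Real Complex

/-! ## §1 The four slit witnesses (reference root `w42 = (4, 2)`, hole `(3, 2)`, slit `(3,1), (3,2), (3,3)`, far cell `(2, 2)`) -/

section Witnesses

/-- Slit witness block `SU2`: the 24 cells of an under w₂-free wound witness (reference root `(4, 2)`, hole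
`(3, 2)`, far cell `(2, 2)`) AVOIDING `holeS (3,1)` AND `holeN (3,3)`; cells in `[1,5]×[-1,4]` (kit j298316 of the lane).
[cite: GlazmanManolescu2019, §2.1 (finite domains of faces)] -/
def slitBlockSU242 : List Face := [(1,-1),(1,0),(1,1),(1,2),(2,-1),(2,0),(2,1),(2,2),(2,3),(2,4),(3,-1),(3,0),(3,4),(4,-1),(4,0),(4,1),(4,2),(4,3),(4,4),(5,-1),(5,0),(5,1),(5,2),(5,3)]

/-- Its mid-edges (24 arcs). [cite: GlazmanManolescu2019, §1 (definition of the model), Fig. 1] -/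
def slitSU2Mids : List MidEdge :=
  [.vert 4 2, .slant 4 2, .slant 4 1, .vert 4 0, .vert 3 0, .slant 2 1, .slant 2 2, .vert 2 2, .slant 1 2, .slant 1 1, .slant 1 0, .vert 2 (-1), .vert 3 (-1), .vert 4 (-1), .vert 5 (-1), .slant 5 0, .slant 5 1, .slant 5 2, .slant 5 3, .vert 5 3, .slant 4 4, .vert 4 4, .vert 3 4, .slant 2 4, .slant 2 3]

/-- The witness as a walk of its block. [cite: GlazmanManolescu2019, §1 (definition of the model), Fig. 1] -/
def slitSU2Walk : YBWalk (dom slitBlockSU242) (w42.side .W) ((farW w42).side .N) where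
  mids := slitSU2Mids
  head_eq := by decide
  getLast_eq := by decide
  nodup := by decide
  arc_mem := arc_mem_of_check (by decide)
  isChain := by decide
  noncross := noncross_of_check (by decide)

/-- The labelled witness. [cite: Glazman2015WeightedSAW, Lemma 3.1 (proof, pp. 6–7)] -/
def ωslitSU2 : ΩG (dom slitBlockSU242) (w42.side .W) (farW w42) := ⟨.N, slitSU2Walk⟩

/-- Certificates: first hit `6`, `24` arcs, no later far-cell arc, first side `S`, w₂-free off the far cell, odd
eastern-ray count. [cite: Glazman2015WeightedSAW, Lemma 3.1 (proof, pp. 6–7)] [cite: CourantRobbins1958, Ch. V Appendix §2 (the even–odd rule)] -/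
theorem ωslitSU2_cert : ωslitSU2.2.firstHitG = 6 ∧ ωslitSU2.2.arcs.length = 24 ∧
    (∀ j < 24, 6 < j → ωslitSU2.2.fc j ≠ farW w42) ∧ ωslitSU2.2.nth 6 = (farW w42).side .S ∧
    ωslitSU2.2.W2FreeOff (farW w42) ∧
    Odd ((Finset.range 18).filter fun j => eastRayB w42 (ωslitSU2.2.nth (6 + j + 1)) = true).card := by
  refine ⟨by decide, by decide, by decide, by decide, by unfold YBWalk.W2FreeOff; decide, by decide⟩

/-- The block at the root plaquette `w`. [cite: GlazmanManolescu2019, §2.1, §4.2 (translation invariance)] -/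
def slitBlockSU2 (w : Face) : List Face := slitBlockSU242.map (Face.shiftBy (refShift w))

/-- ★★★ The under w₂-free wound witness `SU2` at EVERY POSITION: any face list containing the translated block
carries a wound class-`B2a` under-walk at the far cell, w₂-free off it. [cite: GlazmanManolescu2019, §4.2 (translation invariance), Lemma 2.1]
[cite: Glazman2015WeightedSAW, Lemma 3.1 (proof, pp. 6–7)] [cite: CourantRobbins1958, Ch. V Appendix §2 (the even–odd rule)] -/
theorem exists_under_W2FreeOff_of_slitBlockSU2 {Dl : List Face} {w : Face} (hB : ∀ c ∈ slitBlockSU2 w, c ∈ Dl)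
    (hr : RootedFace (dom Dl) (w.side .W) (farW w)) (θ : ℝ) :
    ∃ (ω : ΩG (dom Dl) (w.side .W) (farW w)) (h : ω.IsB2a), ω.2.firstSideG = .S ∧
      ω.WE (fun _ => θ) ≠ excursionWinding θ ω.2.firstSideG (ω.z1 hr h) ω.1 ∧ ω.2.W2FreeOff (farW w) := by
  have hB₀ := block42_mem_of_block_mem (B := slitBlockSU242) hB
  obtain ⟨hF, hn, hfc, hnth, hfree, hodd⟩ := ωslitSU2_cert
  let ω₀ : ΩG (dom (Dl.map (Face.shiftBy (-refShift w)))) (w42.side .W) (farW w42) :=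
    ⟨.N, slitSU2Walk.mapDomain fun c hc => hB₀ c hc⟩
  have hF' : ω₀.2.firstHitG = 6 := hF
  have hn' : ω₀.2.arcs.length = 24 := hn
  have h₀ : ω₀.IsB2a := by
    refine ΩG.isB2a_of_forall_fc_ne (by rw [hF', hn']; omega) fun j hj1 hj2 => ?_
    rw [hF'] at hj1
    rw [hn'] at hj2
    exact hfc j hj2 hj1
  have hM : ω₀.Mv = 18 := by unfold ΩG.Mv; rw [hF', hn']
  exact exists_wound_witness_shift (shiftBy_refShift_root w) (shiftBy_refShift_farW w) hr
    (fun γ r => γ.W2FreeOff r) (fun hm _ hf => YBWalk.W2FreeOff_of_mids_shift hm hf) ω₀ h₀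
    (by rw [hF']; exact hnth) hfree (by rw [hM, hF']; exact hodd) θ

/-- Slit witness block `SU1`: the 22 cells of an under w₁-free wound witness (reference root `(4, 2)`, hole
`(3, 2)`, far cell `(2, 2)`) AVOIDING `holeS (3,1)` AND `holeN (3,3)`; cells in `[1,5]×[-1,4]` (kit j298316 of the lane).
[cite: GlazmanManolescu2019, §2.1 (finite domains of faces)] -/
def slitBlockSU142 : List Face := [(1,0),(1,1),(1,2),(2,-1),(2,0),(2,1),(2,2),(2,3),(2,4),(3,-1),(3,0),(3,4),(4,-1),(4,0),(4,1),(4,2),(4,3),(4,4),(5,-1),(5,0),(5,1),(5,2)]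

/-- Its mid-edges (24 arcs). [cite: GlazmanManolescu2019, §1 (definition of the model), Fig. 1] -/
def slitSU1Mids : List MidEdge :=
  [.vert 4 2, .slant 4 2, .slant 4 1, .vert 4 0, .vert 3 0, .slant 2 1, .slant 2 2, .vert 2 2, .slant 1 2, .slant 1 1, .vert 2 0, .slant 2 0, .vert 3 (-1), .vert 4 (-1), .vert 5 (-1), .slant 5 0, .slant 5 1, .slant 5 2, .vert 5 2, .slant 4 3, .slant 4 4, .vert 4 4, .vert 3 4, .slant 2 4, .slant 2 3]

/-- The witness as a walk of its block. [cite: GlazmanManolescu2019, §1 (definition of the model), Fig. 1] -/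
def slitSU1Walk : YBWalk (dom slitBlockSU142) (w42.side .W) ((farW w42).side .N) where
  mids := slitSU1Mids
  head_eq := by decide
  getLast_eq := by decide
  nodup := by decide
  arc_mem := arc_mem_of_check (by decide)
  isChain := by decide
  noncross := noncross_of_check (by decide)

/-- The labelled witness. [cite: Glazman2015WeightedSAW, Lemma 3.1 (proof, pp. 6–7)] -/
def ωslitSU1 : ΩG (dom slitBlockSU142) (w42.side .W) (farW w42) := ⟨.N, slitSU1Walk⟩

/-- Certificates: first hit `6`, `24` arcs, no later far-cell arc, first side `S`, w₁-free off the far cell, odd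
eastern-ray count. [cite: Glazman2015WeightedSAW, Lemma 3.1 (proof, pp. 6–7)] [cite: CourantRobbins1958, Ch. V Appendix §2 (the even–odd rule)] -/
theorem ωslitSU1_cert : ωslitSU1.2.firstHitG = 6 ∧ ωslitSU1.2.arcs.length = 24 ∧
    (∀ j < 24, 6 < j → ωslitSU1.2.fc j ≠ farW w42) ∧ ωslitSU1.2.nth 6 = (farW w42).side .S ∧
    ωslitSU1.2.W1FreeOff (farW w42) ∧
    Odd ((Finset.range 18).filter fun j => eastRayB w42 (ωslitSU1.2.nth (6 + j + 1)) = true).card := by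
  refine ⟨by decide, by decide, by decide, by decide, by unfold YBWalk.W1FreeOff; decide, by decide⟩

/-- The block at the root plaquette `w`. [cite: GlazmanManolescu2019, §2.1, §4.2 (translation invariance)] -/
def slitBlockSU1 (w : Face) : List Face := slitBlockSU142.map (Face.shiftBy (refShift w))

/-- ★★★ The under w₁-free wound witness `SU1` at EVERY POSITION: any face list containing the translated block
carries a wound class-`B2a` under-walk at the far cell, w₁-free off it. [cite: GlazmanManolescu2019, §4.2 (translation invariance), Lemma 2.1]
[cite: Glazman2015WeightedSAW, Lemma 3.1 (proof, pp. 6–7)] [cite: CourantRobbins1958, Ch. V Appendix §2 (the even–odd rule)] -/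
theorem exists_under_W1FreeOff_of_slitBlockSU1 {Dl : List Face} {w : Face} (hB : ∀ c ∈ slitBlockSU1 w, c ∈ Dl)
    (hr : RootedFace (dom Dl) (w.side .W) (farW w)) (θ : ℝ) :
    ∃ (ω : ΩG (dom Dl) (w.side .W) (farW w)) (h : ω.IsB2a), ω.2.firstSideG = .S ∧
      ω.WE (fun _ => θ) ≠ excursionWinding θ ω.2.firstSideG (ω.z1 hr h) ω.1 ∧ ω.2.W1FreeOff (farW w) := by
  have hB₀ := block42_mem_of_block_mem (B := slitBlockSU142) hB
  obtain ⟨hF, hn, hfc, hnth, hfree, hodd⟩ := ωslitSU1_cert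
  let ω₀ : ΩG (dom (Dl.map (Face.shiftBy (-refShift w)))) (w42.side .W) (farW w42) :=
    ⟨.N, slitSU1Walk.mapDomain fun c hc => hB₀ c hc⟩
  have hF' : ω₀.2.firstHitG = 6 := hF
  have hn' : ω₀.2.arcs.length = 24 := hn
  have h₀ : ω₀.IsB2a := by
    refine ΩG.isB2a_of_forall_fc_ne (by rw [hF', hn']; omega) fun j hj1 hj2 => ?_
    rw [hF'] at hj1
    rw [hn'] at hj2
    exact hfc j hj2 hj1
  have hM : ω₀.Mv = 18 := by unfold ΩG.Mv; rw [hF', hn']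
  exact exists_wound_witness_shift (shiftBy_refShift_root w) (shiftBy_refShift_farW w) hr
    (fun γ r => γ.W1FreeOff r) (fun hm _ hf => YBWalk.W1FreeOff_of_mids_shift hm hf) ω₀ h₀
    (by rw [hF']; exact hnth) hfree (by rw [hM, hF']; exact hodd) θ

/-- Slit witness block `NO2`: the 22 cells of an over w₂-free wound witness (reference root `(4, 2)`, hole
`(3, 2)`, far cell `(2, 2)`) AVOIDING `holeS (3,1)` AND `holeN (3,3)`; cells in `[1,5]×[0,5]` (kit j298316 of the lane).
[cite: GlazmanManolescu2019, §2.1 (finite domains of faces)] -/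
def slitBlockNO242 : List Face := [(1,2),(1,3),(1,4),(2,0),(2,1),(2,2),(2,3),(2,4),(2,5),(3,0),(3,4),(3,5),(4,0),(4,1),(4,2),(4,3),(4,4),(4,5),(5,2),(5,3),(5,4),(5,5)]

/-- Its mid-edges (24 arcs). [cite: GlazmanManolescu2019, §1 (definition of the model), Fig. 1] -/
def slitNO2Mids : List MidEdge :=
  [.vert 4 2, .slant 4 3, .slant 4 4, .vert 4 4, .vert 3 4, .slant 2 4, .slant 2 3, .vert 2 2, .slant 1 3, .slant 1 4, .vert 2 4, .slant 2 5, .vert 3 5, .vert 4 5, .vert 5 5, .slant 5 5, .slant 5 4, .slant 5 3, .vert 5 2, .slant 4 2, .slant 4 1, .vert 4 0, .vert 3 0, .slant 2 1, .slant 2 2]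

/-- The witness as a walk of its block. [cite: GlazmanManolescu2019, §1 (definition of the model), Fig. 1] -/
def slitNO2Walk : YBWalk (dom slitBlockNO242) (w42.side .W) ((farW w42).side .S) where
  mids := slitNO2Mids
  head_eq := by decide
  getLast_eq := by decide
  nodup := by decide
  arc_mem := arc_mem_of_check (by decide)
  isChain := by decide
  noncross := noncross_of_check (by decide)

/-- The labelled witness. [cite: Glazman2015WeightedSAW, Lemma 3.1 (proof, pp. 6–7)] -/
def ωslitNO2 : ΩG (dom slitBlockNO242) (w42.side .W) (farW w42) := ⟨.S, slitNO2Walk⟩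

/-- Certificates: first hit `6`, `24` arcs, no later far-cell arc, first side `N`, w₂-free off the far cell, odd
eastern-ray count. [cite: Glazman2015WeightedSAW, Lemma 3.1 (proof, pp. 6–7)] [cite: CourantRobbins1958, Ch. V Appendix §2 (the even–odd rule)] -/
theorem ωslitNO2_cert : ωslitNO2.2.firstHitG = 6 ∧ ωslitNO2.2.arcs.length = 24 ∧
    (∀ j < 24, 6 < j → ωslitNO2.2.fc j ≠ farW w42) ∧ ωslitNO2.2.nth 6 = (farW w42).side .N ∧
    ωslitNO2.2.W2FreeOff (farW w42) ∧
    Odd ((Finset.range 18).filter fun j => eastRayB w42 (ωslitNO2.2.nth (6 + j + 1)) = true).card := by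
  refine ⟨by decide, by decide, by decide, by decide, by unfold YBWalk.W2FreeOff; decide, by decide⟩

/-- The block at the root plaquette `w`. [cite: GlazmanManolescu2019, §2.1, §4.2 (translation invariance)] -/
def slitBlockNO2 (w : Face) : List Face := slitBlockNO242.map (Face.shiftBy (refShift w))

/-- ★★★ The over w₂-free wound witness `NO2` at EVERY POSITION: any face list containing the translated block
carries a wound class-`B2a` over-walk at the far cell, w₂-free off it. [cite: GlazmanManolescu2019, §4.2 (translation invariance), Lemma 2.1]
[cite: Glazman2015WeightedSAW, Lemma 3.1 (proof, pp. 6–7)] [cite: CourantRobbins1958, Ch. V Appendix §2 (the even–odd rule)] -/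
theorem exists_over_W2FreeOff_of_slitBlockNO2 {Dl : List Face} {w : Face} (hB : ∀ c ∈ slitBlockNO2 w, c ∈ Dl)
    (hr : RootedFace (dom Dl) (w.side .W) (farW w)) (θ : ℝ) :
    ∃ (ω : ΩG (dom Dl) (w.side .W) (farW w)) (h : ω.IsB2a), ω.2.firstSideG = .N ∧
      ω.WE (fun _ => θ) ≠ excursionWinding θ ω.2.firstSideG (ω.z1 hr h) ω.1 ∧ ω.2.W2FreeOff (farW w) := by
  have hB₀ := block42_mem_of_block_mem (B := slitBlockNO242) hB
  obtain ⟨hF, hn, hfc, hnth, hfree, hodd⟩ := ωslitNO2_cert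
  let ω₀ : ΩG (dom (Dl.map (Face.shiftBy (-refShift w)))) (w42.side .W) (farW w42) :=
    ⟨.S, slitNO2Walk.mapDomain fun c hc => hB₀ c hc⟩
  have hF' : ω₀.2.firstHitG = 6 := hF
  have hn' : ω₀.2.arcs.length = 24 := hn
  have h₀ : ω₀.IsB2a := by
    refine ΩG.isB2a_of_forall_fc_ne (by rw [hF', hn']; omega) fun j hj1 hj2 => ?_
    rw [hF'] at hj1
    rw [hn'] at hj2
    exact hfc j hj2 hj1
  have hM : ω₀.Mv = 18 := by unfold ΩG.Mv; rw [hF', hn']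
  exact exists_wound_witness_shift (shiftBy_refShift_root w) (shiftBy_refShift_farW w) hr
    (fun γ r => γ.W2FreeOff r) (fun hm _ hf => YBWalk.W2FreeOff_of_mids_shift hm hf) ω₀ h₀
    (by rw [hF']; exact hnth) hfree (by rw [hM, hF']; exact hodd) θ

/-- Slit witness block `NO1`: the 24 cells of an over w₁-free wound witness (reference root `(4, 2)`, hole
`(3, 2)`, far cell `(2, 2)`) AVOIDING `holeS (3,1)` AND `holeN (3,3)`; cells in `[1,5]×[0,5]` (kit j298316 of the lane).
[cite: GlazmanManolescu2019, §2.1 (finite domains of faces)] -/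
def slitBlockNO142 : List Face := [(1,2),(1,3),(1,4),(1,5),(2,0),(2,1),(2,2),(2,3),(2,4),(2,5),(3,0),(3,4),(3,5),(4,0),(4,1),(4,2),(4,3),(4,4),(4,5),(5,1),(5,2),(5,3),(5,4),(5,5)]

/-- Its mid-edges (24 arcs). [cite: GlazmanManolescu2019, §1 (definition of the model), Fig. 1] -/
def slitNO1Mids : List MidEdge :=
  [.vert 4 2, .slant 4 3, .slant 4 4, .vert 4 4, .vert 3 4, .slant 2 4, .slant 2 3, .vert 2 2, .slant 1 3, .slant 1 4, .slant 1 5, .vert 2 5, .vert 3 5, .vert 4 5, .vert 5 5, .slant 5 5, .slant 5 4, .slant 5 3, .slant 5 2, .vert 5 1, .slant 4 1, .vert 4 0, .vert 3 0, .slant 2 1, .slant 2 2]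

/-- The witness as a walk of its block. [cite: GlazmanManolescu2019, §1 (definition of the model), Fig. 1] -/
def slitNO1Walk : YBWalk (dom slitBlockNO142) (w42.side .W) ((farW w42).side .S) where
  mids := slitNO1Mids
  head_eq := by decide
  getLast_eq := by decide
  nodup := by decide
  arc_mem := arc_mem_of_check (by decide)
  isChain := by decide
  noncross := noncross_of_check (by decide)

/-- The labelled witness. [cite: Glazman2015WeightedSAW, Lemma 3.1 (proof, pp. 6–7)] -/
def ωslitNO1 : ΩG (dom slitBlockNO142) (w42.side .W) (farW w42) := ⟨.S, slitNO1Walk⟩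

/-- Certificates: first hit `6`, `24` arcs, no later far-cell arc, first side `N`, w₁-free off the far cell, odd
eastern-ray count. [cite: Glazman2015WeightedSAW, Lemma 3.1 (proof, pp. 6–7)] [cite: CourantRobbins1958, Ch. V Appendix §2 (the even–odd rule)] -/
theorem ωslitNO1_cert : ωslitNO1.2.firstHitG = 6 ∧ ωslitNO1.2.arcs.length = 24 ∧
    (∀ j < 24, 6 < j → ωslitNO1.2.fc j ≠ farW w42) ∧ ωslitNO1.2.nth 6 = (farW w42).side .N ∧
    ωslitNO1.2.W1FreeOff (farW w42) ∧
    Odd ((Finset.range 18).filter fun j => eastRayB w42 (ωslitNO1.2.nth (6 + j + 1)) = true).card := by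
  refine ⟨by decide, by decide, by decide, by decide, by unfold YBWalk.W1FreeOff; decide, by decide⟩

/-- The block at the root plaquette `w`. [cite: GlazmanManolescu2019, §2.1, §4.2 (translation invariance)] -/
def slitBlockNO1 (w : Face) : List Face := slitBlockNO142.map (Face.shiftBy (refShift w))

/-- ★★★ The over w₁-free wound witness `NO1` at EVERY POSITION: any face list containing the translated block
carries a wound class-`B2a` over-walk at the far cell, w₁-free off it. [cite: GlazmanManolescu2019, §4.2 (translation invariance), Lemma 2.1]
[cite: Glazman2015WeightedSAW, Lemma 3.1 (proof, pp. 6–7)] [cite: CourantRobbins1958, Ch. V Appendix §2 (the even–odd rule)] -/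
theorem exists_over_W1FreeOff_of_slitBlockNO1 {Dl : List Face} {w : Face} (hB : ∀ c ∈ slitBlockNO1 w, c ∈ Dl)
    (hr : RootedFace (dom Dl) (w.side .W) (farW w)) (θ : ℝ) :
    ∃ (ω : ΩG (dom Dl) (w.side .W) (farW w)) (h : ω.IsB2a), ω.2.firstSideG = .N ∧
      ω.WE (fun _ => θ) ≠ excursionWinding θ ω.2.firstSideG (ω.z1 hr h) ω.1 ∧ ω.2.W1FreeOff (farW w) := by
  have hB₀ := block42_mem_of_block_mem (B := slitBlockNO142) hB
  obtain ⟨hF, hn, hfc, hnth, hfree, hodd⟩ := ωslitNO1_cert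
  let ω₀ : ΩG (dom (Dl.map (Face.shiftBy (-refShift w)))) (w42.side .W) (farW w42) :=
    ⟨.S, slitNO1Walk.mapDomain fun c hc => hB₀ c hc⟩
  have hF' : ω₀.2.firstHitG = 6 := hF
  have hn' : ω₀.2.arcs.length = 24 := hn
  have h₀ : ω₀.IsB2a := by
    refine ΩG.isB2a_of_forall_fc_ne (by rw [hF', hn']; omega) fun j hj1 hj2 => ?_
    rw [hF'] at hj1
    rw [hn'] at hj2
    exact hfc j hj2 hj1
  have hM : ω₀.Mv = 18 := by unfold ΩG.Mv; rw [hF', hn']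
  exact exists_wound_witness_shift (shiftBy_refShift_root w) (shiftBy_refShift_farW w) hr
    (fun γ r => γ.W1FreeOff r) (fun hm _ hf => YBWalk.W1FreeOff_of_mids_shift hm hf) ω₀ h₀
    (by rw [hF']; exact hnth) hfree (by rw [hM, hF']; exact hodd) θ

end Witnesses

/-! ## §2–§3 Boxes with a vertical slit -/

section Boxes

variable {m n : ℕ} {h : Face}

/-- Placement of a reference block avoiding `holeS (3,1)` and `holeN (3,3)` in the box minus the slit.
[cite: GlazmanManolescu2019, §2.1 (finite domains of faces), §4.2 (translation invariance)] -/
theorem block_hroot_subset_boxMinus_slit (B : List Face) (x0 x1 y0 y1 : ℤ)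
    (hB : ∀ a ∈ B, x0 ≤ a.1 ∧ a.1 ≤ x1 ∧ y0 ≤ a.2 ∧ a.2 ≤ y1 ∧ a ≠ (3, 2) ∧ a ≠ (3, 1) ∧ a ≠ (3, 3))
    (hW : 3 ≤ x0 + h.1) (hE : x1 + h.1 ≤ m + 2) (hS : 2 ≤ y0 + h.2) (hN : y1 + h.2 ≤ n + 1) :
    ∀ c ∈ B.map (Face.shiftBy (refShift (h.1 + 1, h.2))), c ∈ boxMinus m n [h, (h.1, h.2 - 1), (h.1, h.2 + 1)] := by
  intro c hc'
  rw [List.mem_map] at hc'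
  obtain ⟨a, ha, rfl⟩ := hc'
  obtain ⟨b1, b2, b3, b4, b5, b6, b7⟩ := hB a ha
  obtain ⟨x, y⟩ := a
  simp only [ne_eq, Prod.mk.injEq, not_and] at b1 b2 b3 b4 b5 b6 b7
  rw [shiftBy_refShift_mk, mem_boxMinus]
  simp only [List.mem_cons, List.not_mem_nil, or_false, not_or]
  refine ⟨⟨by omega, by omega, by omega, by omega⟩, fun e => ?_, fun e => ?_, fun e => ?_⟩
  · have e' := Prod.ext_iff.1 e; simp only at e'; omega
  · have e' := Prod.ext_iff.1 e; simp only at e'; omega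
  · have e' := Prod.ext_iff.1 e; simp only at e'; omega

/-- The far cell is kept and the hole root is rooted in the box minus the slit.
[cite: GlazmanManolescu2019, §2.1 (walks start on the boundary of the domain)] -/
theorem rootedFace_hroot_boxMinus_slit (hW : 1 ≤ h.1) (hE : h.1 ≤ m) (hS : 0 ≤ h.2) (hN : h.2 + 1 ≤ n) :
    RootedFace (dom (boxMinus m n [h, (h.1, h.2 - 1), (h.1, h.2 + 1)])) (Face.side (h.1 + 1, h.2) .W) (farW (h.1 + 1, h.2)) := by
  refine rootedFace_hroot_boxMinus_of_mem (farW_hroot_mem_boxMinus_of_not_mem hW hE hS hN ?_) (by simp)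
  simp only [List.mem_cons, List.not_mem_nil, or_false, not_or]
  exact ⟨fun e => by have := (Prod.ext_iff.1 e).1; simp only at this; omega,
    fun e => by have := (Prod.ext_iff.1 e).1; simp only at this; omega,
    fun e => by have := (Prod.ext_iff.1 e).1; simp only at this; omega⟩

/-- ★★★★★ **THE VERTICAL SLIT KILLS NOTHING IN THE INTERIOR.** In the `m × n` box with `2 ≤ h.1`, `h.1 + 3 ≤ m`, `3 ≤ h.2`,
`h.2 + 4 ≤ n`, remove the hole `h` together with `holeS` and `holeN`. Then at every angle NONE of the four universal kill
statements of LAW L holds at the far cell: the four slit witnesses of §1 fit (`[1,5]×[−1,4]` under, `[1,5]×[0,5]` over).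
[cite: GlazmanManolescu2019, §1 (Fig. 2 and the remark after eq. (1)), §2.1, §4.2, Lemma 2.1]
[cite: Glazman2015WeightedSAW, Lemma 3.1 (proof, pp. 6–7)] [cite: CourantRobbins1958, Ch. V Appendix §2 (the even–odd rule)] -/
theorem lawL_box_slit_not_killed (hW : 2 ≤ h.1) (hE : h.1 + 3 ≤ m) (hS : 3 ≤ h.2) (hN : h.2 + 4 ≤ n)
    (hr : RootedFace (dom (boxMinus m n [h, (h.1, h.2 - 1), (h.1, h.2 + 1)])) (Face.side (h.1 + 1, h.2) .W)
      (farW (h.1 + 1, h.2))) (θ : ℝ) :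
    (¬ ∀ (ω : ΩG (dom (boxMinus m n [h, (h.1, h.2 - 1), (h.1, h.2 + 1)])) (Face.side (h.1 + 1, h.2) .W) (farW (h.1 + 1, h.2)))
        (hb : ω.IsB2a), ω.2.firstSideG = .S → ω.WE (fun _ => θ) ≠ excursionWinding θ ω.2.firstSideG (ω.z1 hr hb) ω.1 →
          ¬ω.2.W2FreeOff (farW (h.1 + 1, h.2))) ∧
      (¬ ∀ (ω : ΩG (dom (boxMinus m n [h, (h.1, h.2 - 1), (h.1, h.2 + 1)])) (Face.side (h.1 + 1, h.2) .W) (farW (h.1 + 1, h.2)))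
        (hb : ω.IsB2a), ω.2.firstSideG = .N → ω.WE (fun _ => θ) ≠ excursionWinding θ ω.2.firstSideG (ω.z1 hr hb) ω.1 →
          ¬ω.2.W1FreeOff (farW (h.1 + 1, h.2))) ∧
      (¬ ∀ (ω : ΩG (dom (boxMinus m n [h, (h.1, h.2 - 1), (h.1, h.2 + 1)])) (Face.side (h.1 + 1, h.2) .W) (farW (h.1 + 1, h.2)))
        (hb : ω.IsB2a), ω.2.firstSideG = .S → ω.WE (fun _ => θ) ≠ excursionWinding θ ω.2.firstSideG (ω.z1 hr hb) ω.1 →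
          ¬ω.2.W1FreeOff (farW (h.1 + 1, h.2))) ∧
      (¬ ∀ (ω : ΩG (dom (boxMinus m n [h, (h.1, h.2 - 1), (h.1, h.2 + 1)])) (Face.side (h.1 + 1, h.2) .W) (farW (h.1 + 1, h.2)))
        (hb : ω.IsB2a), ω.2.firstSideG = .N → ω.WE (fun _ => θ) ≠ excursionWinding θ ω.2.firstSideG (ω.z1 hr hb) ω.1 →
          ¬ω.2.W2FreeOff (farW (h.1 + 1, h.2))) := by
  have sub := block_hroot_subset_boxMinus_slit (m := m) (n := n) (h := h)
  exact not_killed_of_witnesses hr θ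
    (exists_under_W2FreeOff_of_slitBlockSU2 (sub slitBlockSU242 1 5 (-1) 4 (by decide) (by omega) (by omega) (by omega)
      (by omega)) hr θ)
    (exists_over_W1FreeOff_of_slitBlockNO1 (sub slitBlockNO142 1 5 0 5 (by decide) (by omega) (by omega) (by omega)
      (by omega)) hr θ)
    (exists_under_W1FreeOff_of_slitBlockSU1 (sub slitBlockSU142 1 5 (-1) 4 (by decide) (by omega) (by omega) (by omega)
      (by omega)) hr θ)
    (exists_over_W2FreeOff_of_slitBlockNO2 (sub slitBlockNO242 1 5 0 5 (by decide) (by omega) (by omega) (by omega)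
      (by omega)) hr θ)

/-- ★★★★★ **THE SLIT WITH THE BOTTOM WALL TWO ROWS BELOW THE HOLE (`h.2 = 2`, `h.2 + 4 ≤ n`): `Im VF > 0` on the whole range** —
the under route is EMPTY by the dead door below (`lawL_box_tightS_not_wound_under`, any defect list), the over slit witnesses
fit. [cite: GlazmanManolescu2019, Lemma 2.1 (statement, "in the form given in [Gl]"), §1 eq. (1), §2.1]
[cite: Glazman2015WeightedSAW, Lemma 3.1 (proof, pp. 6–7)] [cite: CourantRobbins1958, Ch. V Appendix §2 (the even–odd rule)] -/
theorem lawL_box_slit_tightS_im_vertexFunctional_pos (hW : 2 ≤ h.1) (hE : h.1 + 3 ≤ m) (hS2 : h.2 = 2) (hN : h.2 + 4 ≤ n)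
    {θ : ℝ} (hθ : θ ∈ Set.Icc (π / 3) (2 * π / 3)) :
    0 < (vertexFunctional (printedWeights θ) tFiveEighths (ybCoeff θ) (boxMinus m n [h, (h.1, h.2 - 1), (h.1, h.2 + 1)])
      (Face.side (h.1 + 1, h.2) .W) (farW (h.1 + 1, h.2))).im := by
  have sub := block_hroot_subset_boxMinus_slit (m := m) (n := n) (h := h)
  have hh : h ∈ [h, (h.1, h.2 - 1), (h.1, h.2 + 1)] := by simp
  have hfS : ((h.1 - 1, h.2) : Face) ∉ [h, (h.1, h.2 - 1), (h.1, h.2 + 1)] := by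
    simp only [List.mem_cons, List.not_mem_nil, or_false, not_or]
    exact ⟨fun e => by have := (Prod.ext_iff.1 e).1; simp only at this; omega,
      fun e => by have := (Prod.ext_iff.1 e).1; simp only at this; omega,
      fun e => by have := (Prod.ext_iff.1 e).1; simp only at this; omega⟩
  have hf := farW_hroot_mem_boxMinus_of_not_mem (m := m) (n := n) (by omega) (by omega) (by omega) (by omega) hfS
  have hr := rootedFace_hroot_boxMinus_of_mem hf hh
  have hhD : holeFaceW ((h.1 + 1, h.2) : Face) ∉ dom (boxMinus m n [h, (h.1, h.2 - 1), (h.1, h.2 + 1)]) := by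
    rw [holeFaceW_hroot]; exact not_mem_dom_boxMinus_of_mem hh
  refine im_vertexFunctional_printed_pos_of_under_unwound hθ hf hhD hr
    (fun θ' ω hb hs => lawL_box_tightS_not_wound_under (by omega) (by omega) hS2 (by omega) hh hfS
      (Or.inl (by rw [show (h.2 - 1 : ℤ) = 1 by omega]; simp)) ω hb hs θ')
    (exists_over_W2FreeOff_of_slitBlockNO2 (sub slitBlockNO242 1 5 0 5 (by decide) (by omega) (by omega) (by omega)
      (by omega)) hr)
    (exists_over_W1FreeOff_of_slitBlockNO1 (sub slitBlockNO142 1 5 0 5 (by decide) (by omega) (by omega) (by omega)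
      (by omega)) hr)

/-- ★★★★★ **THE SLIT WITH THE TOP WALL TWO ROWS ABOVE THE HOLE (`h.2 + 3 = n`, `3 ≤ h.2`): `Im VF < 0` on the whole range.**
[cite: GlazmanManolescu2019, Lemma 2.1 (statement, "in the form given in [Gl]"), §1 eq. (1), §2.1]
[cite: Glazman2015WeightedSAW, Lemma 3.1 (proof, pp. 6–7)] [cite: CourantRobbins1958, Ch. V Appendix §2 (the even–odd rule)] -/
theorem lawL_box_slit_tightN_im_vertexFunctional_neg (hW : 2 ≤ h.1) (hE : h.1 + 3 ≤ m) (hS : 3 ≤ h.2) (hN3 : h.2 + 3 = n)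
    {θ : ℝ} (hθ : θ ∈ Set.Icc (π / 3) (2 * π / 3)) :
    (vertexFunctional (printedWeights θ) tFiveEighths (ybCoeff θ) (boxMinus m n [h, (h.1, h.2 - 1), (h.1, h.2 + 1)])
      (Face.side (h.1 + 1, h.2) .W) (farW (h.1 + 1, h.2))).im < 0 := by
  have sub := block_hroot_subset_boxMinus_slit (m := m) (n := n) (h := h)
  have hh : h ∈ [h, (h.1, h.2 - 1), (h.1, h.2 + 1)] := by simp
  have hfS : ((h.1 - 1, h.2) : Face) ∉ [h, (h.1, h.2 - 1), (h.1, h.2 + 1)] := by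
    simp only [List.mem_cons, List.not_mem_nil, or_false, not_or]
    exact ⟨fun e => by have := (Prod.ext_iff.1 e).1; simp only at this; omega,
      fun e => by have := (Prod.ext_iff.1 e).1; simp only at this; omega,
      fun e => by have := (Prod.ext_iff.1 e).1; simp only at this; omega⟩
  have hf := farW_hroot_mem_boxMinus_of_not_mem (m := m) (n := n) (by omega) (by omega) (by omega) (by omega) hfS
  have hr := rootedFace_hroot_boxMinus_of_mem hf hh
  have hhD : holeFaceW ((h.1 + 1, h.2) : Face) ∉ dom (boxMinus m n [h, (h.1, h.2 - 1), (h.1, h.2 + 1)]) := by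
    rw [holeFaceW_hroot]; exact not_mem_dom_boxMinus_of_mem hh
  refine im_vertexFunctional_printed_neg_of_over_unwound hθ hf hhD hr
    (fun θ' ω hb hs => lawL_box_tightN_not_wound_over (by omega) (by omega) (by omega) hN3 hh hfS
      (Or.inl (by simp)) ω hb hs θ')
    (exists_under_W2FreeOff_of_slitBlockSU2 (sub slitBlockSU242 1 5 (-1) 4 (by decide) (by omega) (by omega) (by omega)
      (by omega)) hr)
    (exists_under_W1FreeOff_of_slitBlockSU1 (sub slitBlockSU142 1 5 (-1) 4 (by decide) (by omega) (by omega) (by omega)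
      (by omega)) hr)

/-- ★★★★ **THE SLIT IN A BOX OF HEIGHT FIVE: `VF ≡ 0`.** Hole on the middle row (`h.2 = 2`, `n = 5`) of an `m × 5` box
(`1 ≤ h.1 ≤ m`), `holeS` and `holeN` removed: the floor and the ceiling are both two rows from the hole, both doors are dead, no
walk at the far cell is wound (`vertexFunctional_printed_eq_zero_of_deadDoors_floor_ceiling`), whatever the width.
[cite: GlazmanManolescu2019, Lemma 2.1 (statement, "in the form given in [Gl]"), §2.1]
[cite: Glazman2015WeightedSAW, Lemma 3.1 (proof, pp. 6–7)] [cite: CourantRobbins1958, Ch. V Appendix §2 (the even–odd rule)] -/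
theorem lawL_box_slit_height5_vertexFunctional_eq_zero (hW : 1 ≤ h.1) (hE : h.1 ≤ m) (hS2 : h.2 = 2) (hn : n = 5)
    {θ : ℝ} (hθ : θ ∈ Set.Icc (π / 3) (2 * π / 3)) :
    vertexFunctional (printedWeights θ) tFiveEighths (ybCoeff θ) (boxMinus m n [h, (h.1, h.2 - 1), (h.1, h.2 + 1)])
      (Face.side (h.1 + 1, h.2) .W) (farW (h.1 + 1, h.2)) = 0 := by
  have hh : h ∈ [h, (h.1, h.2 - 1), (h.1, h.2 + 1)] := by simp
  have hfS : ((h.1 - 1, h.2) : Face) ∉ [h, (h.1, h.2 - 1), (h.1, h.2 + 1)] := by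
    simp only [List.mem_cons, List.not_mem_nil, or_false, not_or]
    exact ⟨fun e => by have := (Prod.ext_iff.1 e).1; simp only at this; omega,
      fun e => by have := (Prod.ext_iff.1 e).1; simp only at this; omega,
      fun e => by have := (Prod.ext_iff.1 e).1; simp only at this; omega⟩
  have hf := farW_hroot_mem_boxMinus_of_not_mem (m := m) (n := n) (by omega) (by omega) (by omega) (by omega) hfS
  have hhD : holeFaceW ((h.1 + 1, h.2) : Face) ∉ dom (boxMinus m n [h, (h.1, h.2 - 1), (h.1, h.2 + 1)]) := by
    rw [holeFaceW_hroot]; exact not_mem_dom_boxMinus_of_mem hh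
  refine vertexFunctional_printed_eq_zero_of_deadDoors_floor_ceiling hθ hf hhD (Or.inl ?_) (fun y hy hm => ?_) (Or.inl ?_)
    (fun y hy hm => ?_)
  · have e : ((((h.1 + 1, h.2) : Face).1 - 1, ((h.1 + 1, h.2) : Face).2 - 1) : Face) = (h.1, h.2 - 1) :=
      Prod.ext (by simp only; omega) rfl
    rw [e]; exact not_mem_dom_boxMinus_of_mem (by simp)
  · obtain ⟨hb', -⟩ := mem_dom_boxMinus.1 hm
    simp only at hb' hy
    omega
  · have e : ((((h.1 + 1, h.2) : Face).1 - 1, ((h.1 + 1, h.2) : Face).2 + 1) : Face) = (h.1, h.2 + 1) :=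
      Prod.ext (by simp only; omega) rfl
    rw [e]; exact not_mem_dom_boxMinus_of_mem (by simp)
  · obtain ⟨hb', -⟩ := mem_dom_boxMinus.1 hm
    simp only at hb' hy
    omega

end Boxes

end Literature.Barriers.CriticalPhenomena.PlaquetteWalk
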